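import Summits.BirchSwinnertonDyer.BirchSwinnertonDyer.Theorems.ManinLocalTwoThreeGenerationOfRelativeIhara
import Summits.BirchSwinnertonDyer.BirchSwinnertonDyer.Theorems.ManinLocalTwoThreeGenerationOfRelativeIharaTwo
import HarnessLib

/-!
# Route `ManinLocalTwoThree`, cruxes C3 (stmt-22968) / C2 (stmt-22967): the generation stubs from E-es-25-Bar with the
# Eisenstein RESIDUAL stated in the leaves' OWN currency (line prover p3)

`shiftClassGenerationThree_of_relativeIharaBar` / `multiShiftClassGenerationTwo_of_relativeIharaBar` close the generation
stubs E-es-19 / E-es-22 modulo the official single-shift relative Ihara statement (`EsG10.RelativeIharaShiftVanishingBar`,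
bodies verbatim) and a RESIDUAL hypothesis in functional form. Here the residual is re-expressed per curve in the
currency of the leaves themselves: `E-es-19[Eis]` / `E-es-22[Eis]` := the text of `ShiftClassGenerationThree` /
`MultiShiftClassGenerationTwo` VERBATIM with ONE hypothesis inserted — «`ℓ ↦ a_ℓ(W) mod p` is an Eisenstein system over
`𝔽̄_p`» (for irreducible `W[p]` this singles out the image-in-a-nonsplit-Cartan curves: `C₃ = C_ns(2)` at `p = 2`,
es's row E-es-22[C₃]; `C_ns(3) ⊇ C₈, C₄` at `p = 3`). Per-curve bridges `functional_eq_zero_of_shiftClasses` /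
`functional_eq_zero_of_multiShiftClasses` (prime-class generation for ONE `(W, f, ℓ₀)` ⟹ the functional criterion for
that `f`, by the landed span identities and lattice Nakayama), then the two consumers. Conditional by design; nothing
about BSD, Manin's conjecture, E-es-25 or the residual rows is proved here.
-/

set_option autoImplicit false
set_option linter.dupNamespace false

noncomputable section

open scoped MatrixGroups BigOperators

open CongruenceSubgroup Literature.NumberTheory.EllipticCurves.ModularForms
  Literature.NumberTheory.EllipticCurves.ModularForms.HidaCohomology

namespace Summit.BirchSwinnertonDyer.BirchSwinnertonDyer.Theorems.ManinLocalTwoThree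

open scoped Classical ModularForm
open Matrix.SpecialLinearGroup ModularGroup Literature.NumberTheory.EllipticCurves
  Summit.BirchSwinnertonDyer.Rank1Residual.ManinAdditive

/-! ### `p = 3` -/

/-- **Per-curve bridge at `p = 3`**: if for ONE `W`-newform `f` (`9 ∣ N`) and one `ℓ₀` some multiple `mΛ_f`, `3 ∤ m`,
lies in the span of the admissible shift classes `{∞,3a/ℓ} − {∞,a/ℓ}` (`ℓ ≥ ℓ₀`; the instance of E-es-19's body), then
every additive `φ : Λ_f → 𝔽₃` killing `Λ_{f∣ι₃ − f∣ι₁}` vanishes (`shiftSpan_le_periodLattice_shiftOldform` + lattice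
Nakayama `forall_functional_eq_zero_of_mul_subset`). [folklore] -/
theorem functional_eq_zero_of_shiftClasses (W : WeierstrassCurve ℚ) [W.IsElliptic] {N : ℕ} [NeZero N]
    (f : CuspForm (Gamma0 N) 2) (h9 : 3 ^ 2 ∣ N) (ℓ₀ : ℕ)
    (H : ∃ m : ℕ, ¬ 3 ∣ m ∧ ∀ z ∈ periodLattice f,
      (m : ℂ) * z ∈ AddSubgroup.closure
        {z : ℂ | ∃ ℓ ∈ {ℓ : ℕ | ℓ₀ ≤ ℓ ∧ (ℓ.Prime ∧ ¬ ℓ ∣ N ∧ ℓ % 12 = 11 ∧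
            ∀ q ∈ N.primeFactors, ¬ q ^ 2 ∣ N →
              jacobiSym (q : ℤ) ℓ = (if ((q : ℤ) * W.LFunction q) % 3 = 1 then -1 else 1))},
          ∃ a : ℕ, 0 < a ∧ a < ℓ ∧
            z = (modularSymbol f (((3 * a : ℕ) : ℚ) / ℓ) - modularSymbol f 0) -
                (modularSymbol f ((a : ℚ) / ℓ) - modularSymbol f 0)})
    (φ : ↥(periodLattice f) →+ ZMod 3)
    (hφ : ∀ x : ↥(periodLattice f), (x : ℂ) ∈
      periodLattice (degeneracyMap0 N (3 * N) 3 2 f - degeneracyMap0 N (3 * N) 1 2 f) → φ x = 0) :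
    φ = 0 := by
  obtain ⟨m, hm, hgen⟩ := H
  have hle := shiftSpan_le_periodLattice_shiftOldform f (epsSign W) (epsSign_eq_one_or W)
    (by norm_num at h9; exact h9) ℓ₀
  simp only [epsSign] at hle
  exact forall_functional_eq_zero_of_mul_subset _ _ 3 hm (fun z hz => hle (hgen z hz)) φ hφ

/-- **E-es-19 ⟸ E-es-25-Bar(3,3,1) ∧ E-es-19[Eis]** — the residual in the leaf's own currency: `hRes` is the text of
`ShiftClassGenerationThree` VERBATIM with the single extra hypothesis «`ℓ ↦ a_ℓ(W) mod 3` is `IsEisensteinEigensystem 2`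
over `𝔽̄₃`» (irreducible-but-not-absolutely-irreducible `ρ̄_{W,3}`); `hRI` is the body of
`EsG10.RelativeIharaShiftVanishingBar 3 3 1` VERBATIM. [folklore] -/
theorem shiftClassGenerationThree_of_relativeIharaBar_of_residual
    (hRI : ∀ (K : Type) [Field K] [CharP K 3] (L : ℕ) [NeZero L] [NeZero (3 : ℕ)] (S : Finset ℕ) (lam : ℕ → K)
      (u : cocycles 0 L K),
      (∀ q : ℕ, q.Prime → q ∣ 3 * 3 * L → q ∈ S) →
      IsHeckeGenEigenvector S lam u →
      ¬ IsEisensteinEigensystem 2 (fun ℓ => algebraMap K (AlgebraicClosure K) (lam ℓ)) →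
      degeneracyPullback 0 L (L * 3 ^ 1) (3 ^ 1) K dvd_rfl (u : Gamma0 L → Fin 1 → K) =
        degeneracyPullback 0 L (L * 3 ^ 1) 1 K (by simp) (u : Gamma0 L → Fin 1 → K) →
      u = 0)
    (hRes : ∀ (W : WeierstrassCurve ℚ) [W.IsElliptic] {N : ℕ} [NeZero N] (f : CuspForm (Gamma0 N) 2) (ℓ₀ : ℕ),
      IsNewformOf W f → 3 ^ 2 ∣ N → W.HasIrreducibleModPGaloisRep 3 →
      IsEisensteinEigensystem 2
        (fun ℓ : ℕ => algebraMap (ZMod 3) (AlgebraicClosure (ZMod 3)) ((W.LFunction ℓ : ℤ) : ZMod 3)) →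
      ∃ m : ℕ, ¬ 3 ∣ m ∧ ∀ z ∈ periodLattice f,
        (m : ℂ) * z ∈ AddSubgroup.closure
          {z : ℂ | ∃ ℓ ∈ {ℓ : ℕ | ℓ₀ ≤ ℓ ∧ (ℓ.Prime ∧ ¬ ℓ ∣ N ∧ ℓ % 12 = 11 ∧
              ∀ q ∈ N.primeFactors, ¬ q ^ 2 ∣ N →
                jacobiSym (q : ℤ) ℓ = (if ((q : ℤ) * W.LFunction q) % 3 = 1 then -1 else 1))},
            ∃ a : ℕ, 0 < a ∧ a < ℓ ∧
              z = (modularSymbol f (((3 * a : ℕ) : ℚ) / ℓ) - modularSymbol f 0) -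
                  (modularSymbol f ((a : ℚ) / ℓ) - modularSymbol f 0)}) :
    ShiftClassGenerationThree :=
  shiftClassGenerationThree_of_relativeIharaBar hRI fun W _ _ _ f hf h9 hirr hE φ hφ =>
    functional_eq_zero_of_shiftClasses W f h9 0 (hRes W f 0 hf h9 hirr hE) φ hφ

/-! ### `p = 2` -/

/-- **Per-curve bridge at `p = 2`**: if for ONE `W`-newform `f` (`4 ∣ N`) and one `ℓ₀` some odd multiple `mΛ_f` lies in
the span of the depleted prime classes `Σ_T (−1)^{|T|} {∞, a∏T/ℓ}` (`ℓ ≥ ℓ₀` admissible; the instance of E-es-22's body),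
then every additive `φ : Λ_f → 𝔽₂` killing `Λ_{h₂}` vanishes (`multiShiftSpan_admissible_eq_periodLattice_oldform` +
lattice Nakayama). [folklore] -/
theorem functional_eq_zero_of_multiShiftClasses (W : WeierstrassCurve ℚ) [W.IsElliptic] {N : ℕ} [NeZero N]
    (f : CuspForm (Gamma0 N) 2) (h4 : 2 ^ 2 ∣ N) (ℓ₀ : ℕ)
    (H : ∃ m : ℕ, ¬ 2 ∣ m ∧ ∀ z ∈ periodLattice f, (m : ℂ) * z ∈ AddSubgroup.closure
      {z : ℂ | ∃ ℓ ∈ {ℓ : ℕ | ℓ₀ ≤ ℓ ∧ (ℓ.Prime ∧ ¬ ℓ ∣ N ∧ ℓ % 4 = 3 ∧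
          ∀ t ∈ insert 8 (N.primeFactors.filter fun q => ¬ q ^ 2 ∣ N),
            (t : ZMod ℓ) ≠ 1 ∧ (t : ZMod ℓ) ≠ -1)},
        ∃ a : ℕ, 0 < a ∧ a < ℓ ∧
          z = ∑ T ∈ (insert 8 (N.primeFactors.filter fun q => ¬ q ^ 2 ∣ N)).powerset,
                (-1 : ℂ) ^ T.card * primeClass f ℓ (a * ∏ t ∈ T, t)})
    (φ : ↥(periodLattice f) →+ ZMod 2)
    (hφ : ∀ x : ↥(periodLattice f), (x : ℂ) ∈
      periodLattice (∑ T ∈ (insert 8 (N.primeFactors.filter fun q => ¬ q ^ 2 ∣ N)).powerset,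
        (-1 : ℂ) ^ T.card • degeneracyMap0 N (8 * N ^ 2) (∏ t ∈ T, t - 1 + 1) 2 f) → φ x = 0) :
    φ = 0 := by
  haveI : Fact (Nat.Prime 2) := ⟨Nat.prime_two⟩
  obtain ⟨m, hm, hgen⟩ := H
  have heq := multiShiftSpan_admissible_eq_periodLattice_oldform f h4 ℓ₀
  simp only [primeClass] at hgen
  exact forall_functional_eq_zero_of_mul_subset _ _ 2 hm (fun z hz => heq ▸ hgen z hz) φ hφ

/-- **E-es-22 ⟸ E-es-25-Bar at `(2,2,3)`, `(2,q,1)` (`q` odd prime) ∧ E-es-22[Eis]** — the residual in the leaf's own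
currency: `hRes` is the text of `MultiShiftClassGenerationTwo` VERBATIM with the single extra hypothesis «`ℓ ↦ a_ℓ(W) mod 2`
is `IsEisensteinEigensystem 2` over `𝔽̄₂`» (the `C₃`-image curves; es's row E-es-22[C₃]); `hRI8`, `hRIq` are the bodies of
`EsG10.RelativeIharaShiftVanishingBar 2 2 3`, `2 t 1` VERBATIM. [folklore] -/
theorem multiShiftClassGenerationTwo_of_relativeIharaBar_of_residual
    (hRI8 : ∀ (K : Type) [Field K] [CharP K 2] (L : ℕ) [NeZero L] [NeZero (2 : ℕ)] (S : Finset ℕ) (lam : ℕ → K)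
      (u : cocycles 0 L K),
      (∀ q : ℕ, q.Prime → q ∣ 2 * 2 * L → q ∈ S) →
      IsHeckeGenEigenvector S lam u →
      ¬ IsEisensteinEigensystem 2 (fun ℓ => algebraMap K (AlgebraicClosure K) (lam ℓ)) →
      degeneracyPullback 0 L (L * 2 ^ 3) (2 ^ 3) K dvd_rfl (u : Gamma0 L → Fin 1 → K) =
        degeneracyPullback 0 L (L * 2 ^ 3) 1 K (by simp) (u : Gamma0 L → Fin 1 → K) →
      u = 0)
    (hRIq : ∀ t : ℕ, t.Prime → t ≠ 2 →
      ∀ (K : Type) [Field K] [CharP K 2] (L : ℕ) [NeZero L] [NeZero t] (S : Finset ℕ) (lam : ℕ → K)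
      (u : cocycles 0 L K),
      (∀ q : ℕ, q.Prime → q ∣ 2 * t * L → q ∈ S) →
      IsHeckeGenEigenvector S lam u →
      ¬ IsEisensteinEigensystem 2 (fun ℓ => algebraMap K (AlgebraicClosure K) (lam ℓ)) →
      degeneracyPullback 0 L (L * t ^ 1) (t ^ 1) K dvd_rfl (u : Gamma0 L → Fin 1 → K) =
        degeneracyPullback 0 L (L * t ^ 1) 1 K (by simp) (u : Gamma0 L → Fin 1 → K) →
      u = 0)
    (hRes : ∀ (W : WeierstrassCurve ℚ) [W.IsElliptic] {N : ℕ} [NeZero N] (f : CuspForm (Gamma0 N) 2) (ℓ₀ : ℕ),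
      IsNewformOf W f → 2 ^ 2 ∣ N → W.HasIrreducibleModPGaloisRep 2 →
      IsEisensteinEigensystem 2
        (fun ℓ : ℕ => algebraMap (ZMod 2) (AlgebraicClosure (ZMod 2)) ((W.LFunction ℓ : ℤ) : ZMod 2)) →
      ∃ m : ℕ, ¬ 2 ∣ m ∧ ∀ z ∈ periodLattice f, (m : ℂ) * z ∈ AddSubgroup.closure
        {z : ℂ | ∃ ℓ ∈ {ℓ : ℕ | ℓ₀ ≤ ℓ ∧ (ℓ.Prime ∧ ¬ ℓ ∣ N ∧ ℓ % 4 = 3 ∧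
            ∀ t ∈ insert 8 (N.primeFactors.filter fun q => ¬ q ^ 2 ∣ N),
              (t : ZMod ℓ) ≠ 1 ∧ (t : ZMod ℓ) ≠ -1)},
          ∃ a : ℕ, 0 < a ∧ a < ℓ ∧
            z = ∑ T ∈ (insert 8 (N.primeFactors.filter fun q => ¬ q ^ 2 ∣ N)).powerset,
                  (-1 : ℂ) ^ T.card * primeClass f ℓ (a * ∏ t ∈ T, t)}) :
    MultiShiftClassGenerationTwo :=
  multiShiftClassGenerationTwo_of_relativeIharaBar hRI8 hRIq fun W _ _ _ f hf h4 hirr hE φ hφ =>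
    functional_eq_zero_of_multiShiftClasses W f h4 0 (hRes W f 0 hf h4 hirr hE) φ hφ

end Summit.BirchSwinnertonDyer.BirchSwinnertonDyer.Theorems.ManinLocalTwoThree

end
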